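import Summits.BirchSwinnertonDyer.BirchSwinnertonDyer.Theorems.ByReductionTypeAtTwoSupersingularFlatRoad
import HarnessLib

/-!
# Route `ByReductionTypeAtTwo` (rung K4), crux `SupersingularRankZeroAtTwo` (item
# stmt-BirchSwinnertonDyer-19097): THE ♭ COLEMAN ROAD AT `p = 2`, part 2 — the KATO HALF
# `MissingUpperBoundAt W 2` on the whole good-supersingular sub-class (`a₂ ∈ {0, ±2}`) from the ♭ upper
# divisibility and the ♭ `Γ`-Euler characteristic READ AT `2`, and the certificate-fed doors
# (seat `bsd-2adic-ss-1`, GEN 9; sequel of `…SupersingularFlatRoad.lean`)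

HONEST FRAMING (cell `bsd-2adic`, run/shared/lean/pub/bsd-2adic/, HUMAN RULINGS D-0036/D-0054/D-0074):
THEOREMS ONLY; every research input an explicit hypothesis on SUPPLIED local data `(κ, γ, ι, g, c)`; no
definition, no named fact, no instance, no `sorry`; nothing booked; BSD is NOT proved by any of this.
PARTITION (D-0054): X5@2 good-supersingular, `a₂ = ±2` sub-row (B1·O1; 549 rank-`0` classes = 483 with
`a₂ = 2` + 66 with `a₂ = −2`) × `p = 2` — types-the-object-of; closes none.

## What this file proves (the ♭ twin of `…SupersingularHalvesTwo.lean` / `…SupersingularPinch.lean` §1)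

* `missingUpperBoundAt_two_of_flatUpper` — PUB {modularity, GZK} + for the supplied data: the ♭
  `Γ`-Euler characteristic at `2` (`hEC`, Sprung 2024 §5.2 Lemmas 5.5·5.8·5.9 READ AT `2`: for `X^♭` f.g.
  torsion with `char X^♭ = (f)`, `f(0) = u·2^{v₂∏c_ℓ}·#Sel_{2^∞}(E/ℚ)`) and the ♭ upper divisibility at `2`
  (`hup`: `X^♭` torsion, `char X^♭ = (g')`, `ι(g'·h) = ϖ·ι L♭` over every Sprung pair at `2` — the output of
  `SSFlatRoad.flatUpper_two_of_flatColemanKato{,_of_mu}`) ⇒ `ord₂ #Ш ≤ ord₂ #Ш_an`. The one arithmetic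
  input special to `2`: `ϖ·L♭(0) = c♭·L(E,1)/Ω_E` with `c♭ = −a₂² + 2a₂ + 1 ∈ {1, −7}` a `2`-ADIC UNIT on
  `a₂ ∈ {0, ±2}` (`constantCoeff_flat_two_of_isSprungPair_of_isNewformOf`, Sprung 2017 Cor. 4.11 row
  `p = 2`) — no exceptional factor on the ♭ side (the ♯ constants `−4, 2, 6` are NOT units).
* `bsdp_two_of_flatUpper_of_pow_dvd` — the certificate-fed door from `hup` (the shape for a curve
  WITHOUT a `2`-adic image certificate: binder = the ♭ upper divisibility at the curve);
  `bsdp_two_of_flatColemanKato_of_pow_dvd` — the certificate-fed door on the Coleman road (Kato's two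
  facts + `TwoAdicSurjective W` + the ♭ package + EC♭ + `#Ш_an = q`, `v₂ q ≤ m`, `2^m ∣ #Ш` ⇒ `BSD(E,2)`),
  the shape the class instances apply.
Sprung's pair at `2` EXISTS (`exists_isSprungPair_two`) and a dual datum EXISTS for any data
(`Sprung2012.nonempty_sharpFlatSelmerDualData`, f.g. by `SharpFlatSelmerDualData.moduleFinite`), so the
∀-quantified binders are instantiated inside the proofs; `E(ℚ)[2] = 0` at a good supersingular `2`
(`P2.irr_two_of_goodSS_two`) removes the torsion term.

References: [Sprung2012] Thm. 7.14, 7.16, Main Conj. 7.21 (pp. 1504–1505); [Sprung2024] §5.2 Lemmas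
5.5–5.9 (pp. 40–41); [Sprung2017] Thm. 1.12, Cor. 4.4, Cor. 4.11; [Kato2004Asterisque] Thm. 12.4–12.5;
[KuriharaOtsuki2006] p. 564; [GreenbergLNM1716] §4 Lemma 4.2; [Cassels1998] §1; [Miller2011LMS] Def. 1.1.
-/

set_option autoImplicit false
-- the Theorems namespace of this sub repeats the summit name by design (D-0017 nested layout)
set_option linter.dupNamespace false

noncomputable section

open scoped Classical MatrixGroups ModularForm

open CongruenceSubgroup WeierstrassCurve Literature.NumberTheory.EllipticCurves
  Literature.NumberTheory.EllipticCurves.ModularForms Literature.NumberTheory.EllipticCurves.Sprung2017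
  Literature.NumberTheory.EllipticCurves.Sprung2012
  Literature.NumberTheory.EllipticCurves.Rank1Residual Literature.NumberTheory.EllipticCurves.Rank1Residual.Typed
  Literature.NumberTheory.EllipticCurves.IwasawaDual Literature.NumberTheory.GaloisRepresentations
  ZpExtension Summit.BirchSwinnertonDyer.Rank1Residual Summit.BirchSwinnertonDyer.Rank1Residual.Supersingular
  Summit.BirchSwinnertonDyer.Rank1Residual.X5.O1

universe u

namespace Summit.BirchSwinnertonDyer.BirchSwinnertonDyer.Theorems

namespace SSFlatRoad

/-! ## §3 `p = 2`, colour `♭`: the Kato half and the certificate-fed doors -/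

section Door

variable (W : WeierstrassCurve ℚ) [W.IsElliptic] [W.IsGloballyMinimal]
  {κ : ZpExtension ℚ 2} {γ : Field.absoluteGaloisGroup ℚ}
  {E : Type} [Field E] [Algebra ℚ E] (ι : AlgebraicClosure ℚ →ₐ[ℚ] AlgebraicClosure E)
  (g : Field.absoluteGaloisGroup E) (c : ℕ → localPoints W E)

/-- **THE KATO HALF AT `p = 2` ON SPRUNG'S REAL `X^♭(E/ℚ_∞)`** (any `a₂ ∈ {0, ±2}`; the `a₂ = ±2`
sub-row is the new ground). PUB {modularity `hmod`, GZK `hGZK`} + for the SUPPLIED data `(κ, γ, ι, g, c)`: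
the ♭ `Γ`-Euler characteristic at `2` (`hEC`: for `X^♭` f.g. torsion with `char X^♭ = (f)` and
`Sel_{2^∞}(E/ℚ)` finite, `f(0) = u·2^{v₂∏c_ℓ}·#Sel_{2^∞}(E/ℚ)` — Sprung 2024 L5.5·5.8·5.9 READ AT `2`) and
the ♭ upper divisibility at `2` (`hup`: `X^♭` torsion, `char X^♭ = (g')`, `ι(g'·h) = ϖ·ι L♭` over every Sprung
pair at `2` — the conclusion of `flatUpper_two_of_flatColemanKato{,_of_mu}`) ⇒ `ord₂ #Ш ≤ ord₂ #Ш_an`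
(`MissingUpperBoundAt W 2`). Chain: Sprung's pair at `2` EXISTS (`exists_isSprungPair_two`), a dual datum
EXISTS (`nonempty_sharpFlatSelmerDualData`, f.g. by `moduleFinite`); `g'(0)·h(0) = ϖ·L♭(0) = c♭·t` with
`t = L(E,1)/Ω_E`, `c♭ = −a₂² + 2a₂ + 1` a `2`-adic unit; EC♭ gives `v₂ g'(0) = v₂∏c + v₂#Ш`
(`valuation_constantCoeff_xi`); `h ∈ Λ` so `v₂∏c + v₂#Ш ≤ v₂ t`; `#E(ℚ)[2] = 1` (`P2.irr_two_of_goodSS_two`).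
[cite: Sprung2012, Thm. 7.14 and Thm. 7.16 (p. 1504)] [cite: Sprung2024, §5.2 Lemmas 5.5–5.9 (pp. 40–41)]
[cite: Sprung2017, Cor. 4.4 and Cor. 4.11 (row `p = 2`)] [cite: Miller2011LMS, Def. 1.1] -/
theorem missingUpperBoundAt_two_of_flatUpper
    (hmod : nonempty_modularParametrizationData)
    (hGZK : rank_eq_analyticRank_of_analyticRank_le_one)
    (hgood : W.HasGoodReductionAtPrime 2) (hss : (2 : ℤ) ∣ W.frobeniusTrace 2)
    (hL : W.entireLFunction 1 ≠ 0) (hγ : κ.IsTopGenerator γ)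
    (hEC : ∀ (D : SharpFlatSelmerDualData W κ γ ι (W.frobeniusTrace 2) g c .flat)
        [Module.Finite (IwasawaAlgebra 2) D.X], Module.IsTorsion (IwasawaAlgebra 2) D.X →
      ∀ f : IwasawaAlgebra 2, D.charIdeal = Ideal.span {f} → Finite (W.selmerGroupPInfty 2) →
        ∃ u : ℤ_[2]ˣ, ((PowerSeries.constantCoeff f : ℤ_[2]) : ℚ_[2]) =
          ((u : ℤ_[2]) : ℚ_[2]) * ((2 : ℕ) : ℚ_[2]) ^ (padicValNat 2 W.tamagawaProduct) *
            (Nat.card (W.selmerGroupPInfty 2) : ℚ_[2]))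
    (hup : ∀ [NeZero (W.conductorNorm ℤ)] (f : CuspForm (Gamma0 (W.conductorNorm ℤ)) 2),
        IsNewformOf W f → ∀ (ϖ : ℚ), (ϖ : ℝ) * W.realPeriodRat = plusPeriod f →
      ∀ (Ls Lf : IwasawaAlgebra 2), IsSprungPair f 2 (W.frobeniusTrace 2) Ls Lf →
      ∀ (D : SharpFlatSelmerDualData W κ γ ι (W.frobeniusTrace 2) g c .flat),
        Module.IsTorsion (IwasawaAlgebra 2) D.X ∧
        ∃ g' h : IwasawaAlgebra 2, D.charIdeal = Ideal.span {g'} ∧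
          iwasawaToPowerSeries 2 (g' * h) = PowerSeries.C (ϖ : ℚ_[2]) * iwasawaToPowerSeries 2 Lf) :
    MissingUpperBoundAt W 2 := by
  have hr : W.analyticRank = 0 := analyticRank_eq_zero_of_entireLFunction_one_ne_zero W hL
  have hirr : W.HasIrreducibleModPGaloisRep 2 := P2.irr_two_of_goodSS_two W ⟨hgood, hss⟩
  -- modularity: the newform `f` of `E` and the (rational, positive) period ratio `ϖ`
  haveI : NeZero (W.conductorNorm ℤ) := ⟨(W.conductorNorm_pos_holds).ne'⟩
  obtain ⟨Dm⟩ := hmod W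
  set f := Dm.f with hf_def
  have hf : IsNewformOf W f := Dm.isNewformOf
  obtain ⟨ϖ, hϖpos, hϖeq, hΩpos⟩ := Dm.exists_rat_mul_realPeriodRat_eq_plusPeriod
  set s : ℚ := ratPlusSymbol f 0 with hs_def
  set t : ℚ := ϖ * s with ht_def
  have hLval : W.entireLFunction 1 = (((s : ℝ) * plusPeriod f : ℝ) : ℂ) := hf.entireLFunction_one_eq
  have ht : W.entireLFunction 1 / (W.realPeriodRat : ℂ) = ((t : ℚ) : ℂ) := by
    rw [hLval, ← hϖeq, div_eq_iff (Complex.ofReal_ne_zero.mpr hΩpos.ne'), ht_def]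
    push_cast
    ring
  have hs0 : s ≠ 0 := by
    intro h0
    apply hL
    rw [hLval, h0]
    simp
  have ht0 : t ≠ 0 := mul_ne_zero hϖpos.ne' hs0
  -- Sprung's pair at `2`, a dual datum of `Sel^♭(E/ℚ_∞)` for the supplied data
  obtain ⟨Ls, Lf, hSP⟩ := exists_isSprungPair_two hf hgood hss
  obtain ⟨D⟩ := nonempty_sharpFlatSelmerDualData W κ ι (W.frobeniusTrace 2) g c Chroma.flat hγ
  haveI : Module.Finite (IwasawaAlgebra 2) D.X := D.moduleFinite hγ
  obtain ⟨hTors, g', h, hchar, hgh⟩ := hup f hf ϖ hϖeq Ls Lf hSP D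
  -- EC♭ at `2` for `ξ := g'`
  have hK : (⟨g', 0, 0⟩ : SignedDatum W 2).EulerCharacteristic := fun hfin ↦
    hEC D hTors g' hchar hfin
  obtain ⟨hg0ne, hvg⟩ := valuation_constantCoeff_xi W 2 hGZK hL ⟨g', 0, 0⟩ hK
  -- the `♭` constant at `2`: `L♭(0) = c♭·[0]⁺_f`, `c♭ = −a₂² + 2a₂ + 1` a `2`-adic unit
  set cf : ℚ := -(W.frobeniusTrace 2 : ℚ) ^ 2 + 2 * (W.frobeniusTrace 2) + 1 with hcf_def
  have hLf0 := constantCoeff_flat_two_of_isSprungPair_of_isNewformOf hf hgood hSP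
  have hcf1 : cf = 1 ∨ cf = -7 := by
    rcases frobeniusTrace_two_eq_zero_or W hgood hss with h | h | h
    · left; rw [hcf_def, h]; norm_num
    · left; rw [hcf_def, h]; norm_num
    · right; rw [hcf_def, h]; norm_num
  have hcfv : padicValRat 2 cf = 0 := by
    rcases hcf1 with h1 | h1 <;> rw [h1]
    · simp
    · rw [show (-7 : ℚ) = ((-7 : ℤ) : ℚ) by norm_num, padicValRat.of_int]
      norm_num [padicValInt, padicValNat.eq_zero_of_not_dvd]
  have hcf0 : cf ≠ 0 := by rcases hcf1 with h1 | h1 <;> rw [h1] <;> norm_num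
  have hϖLf : (ϖ : ℚ_[2]) * ((PowerSeries.constantCoeff Lf : ℤ_[2]) : ℚ_[2]) =
      (((cf * t : ℚ)) : ℚ_[2]) := by
    rw [hLf0, ht_def, hcf_def]
    push_cast
    ring
  -- the Kato side: `g'(0) · h(0) = ϖ · L♭(0) = c♭ · t`
  have hc := congrArg PowerSeries.constantCoeff hgh
  rw [constantCoeff_iwasawaToPowerSeries, map_mul, PadicInt.coe_mul, map_mul,
    PowerSeries.constantCoeff_C, constantCoeff_iwasawaToPowerSeries, hϖLf] at hc
  have hctQ : (((cf * t : ℚ)) : ℚ_[2]) ≠ 0 := by exact_mod_cast mul_ne_zero hcf0 ht0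
  have hh0 : ((PowerSeries.constantCoeff h : ℤ_[2]) : ℚ_[2]) ≠ 0 := fun h0 ↦
    hctQ (by rw [← hc, h0, mul_zero])
  have hval := congrArg Padic.valuation hc
  rw [Padic.valuation_mul hg0ne hh0, Padic.valuation_ratCast, hvg,
    padicValRat.mul hcf0 ht0, hcfv, zero_add] at hval
  have hhnn := valuation_coe_padicInt_nonneg _ hh0
  refine ⟨t * (W.torsionOrder : ℚ) ^ 2 / (W.tamagawaProduct : ℚ),
    shaAn_eq_of_analyticRank_eq_zero W hGZK hr ht, ?_⟩
  rw [padicValRat_shaAn_witness W 2 hirr ht0]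
  linarith

/-- **The certificate-fed ♭ door.** The descent half supplied as a FINITE DATUM — `#Ш_an = q` (record),
`v₂ q ≤ m`, `2^m ∣ #Ш(E/ℚ)` (per curve a Cassels–Tate / higher-descent certificate, eng-2's CERT-CT2-X5ALL
`Ш[2] ⊂ 2Ш[4]` giving `m = 4`, CERT-L3-CT42 `m = 6`) — plus the Kato half from the ♭ road
(`missingUpperBoundAt_two_of_flatUpper`) ⇒ `BSD(E,2)` for this curve. Any `a₂ ∈ {0, ±2}`.
[cite: Miller2011LMS, Def. 1.1] [cite: Cassels1998, §1] [cite: Sprung2012, Thm. 7.16 and Main Conj. 7.21] -/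
theorem bsdp_two_of_flatUpper_of_pow_dvd
    (hmod : nonempty_modularParametrizationData)
    (hGZK : rank_eq_analyticRank_of_analyticRank_le_one)
    (hgood : W.HasGoodReductionAtPrime 2) (hss : (2 : ℤ) ∣ W.frobeniusTrace 2)
    (hL : W.entireLFunction 1 ≠ 0) (hγ : κ.IsTopGenerator γ)
    (hEC : ∀ (D : SharpFlatSelmerDualData W κ γ ι (W.frobeniusTrace 2) g c .flat)
        [Module.Finite (IwasawaAlgebra 2) D.X], Module.IsTorsion (IwasawaAlgebra 2) D.X →
      ∀ f : IwasawaAlgebra 2, D.charIdeal = Ideal.span {f} → Finite (W.selmerGroupPInfty 2) →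
        ∃ u : ℤ_[2]ˣ, ((PowerSeries.constantCoeff f : ℤ_[2]) : ℚ_[2]) =
          ((u : ℤ_[2]) : ℚ_[2]) * ((2 : ℕ) : ℚ_[2]) ^ (padicValNat 2 W.tamagawaProduct) *
            (Nat.card (W.selmerGroupPInfty 2) : ℚ_[2]))
    (hup : ∀ [NeZero (W.conductorNorm ℤ)] (f : CuspForm (Gamma0 (W.conductorNorm ℤ)) 2),
        IsNewformOf W f → ∀ (ϖ : ℚ), (ϖ : ℝ) * W.realPeriodRat = plusPeriod f →
      ∀ (Ls Lf : IwasawaAlgebra 2), IsSprungPair f 2 (W.frobeniusTrace 2) Ls Lf →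
      ∀ (D : SharpFlatSelmerDualData W κ γ ι (W.frobeniusTrace 2) g c .flat),
        Module.IsTorsion (IwasawaAlgebra 2) D.X ∧
        ∃ g' h : IwasawaAlgebra 2, D.charIdeal = Ideal.span {g'} ∧
          iwasawaToPowerSeries 2 (g' * h) = PowerSeries.C (ϖ : ℚ_[2]) * iwasawaToPowerSeries 2 Lf)
    {q : ℚ} (hq : shaAn W = (q : ℂ)) {m : ℕ} (hv : padicValRat 2 q ≤ m)
    (hdvd : 2 ^ m ∣ W.shaOrder) : BSDp W 2 := by
  have hr : W.analyticRank = 0 := analyticRank_eq_zero_of_entireLFunction_one_ne_zero W hL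
  haveI : Finite W.sha := (hGZK W (by omega)).2
  have hn : W.shaOrder ≠ 0 := by
    rw [WeierstrassCurve.shaOrder]
    exact (Nat.card_pos (α := W.sha)).ne'
  have hle : m ≤ padicValNat 2 W.shaOrder := (padicValNat_dvd_iff_le hn).1 hdvd
  have hlow : MissingLowerBoundAt W 2 := ⟨q, hq, hv.trans (by exact_mod_cast hle)⟩
  exact bsdp_of_missingPPartAt W 2 hGZK (by omega) (missingPPartAt_of_lower_of_upper W 2 hlow
    (missingUpperBoundAt_two_of_flatUpper W ι g c hmod hGZK hgood hss hL hγ hEC hup))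

/-- **The certificate-fed ♭ door on the Coleman road** (image-certificate branch): Kato's two facts, the
`2`-adic image certificate `TwoAdicSurjective W`, the ♭ package for the supplied data (F1♭·F3♭·F4rat·F4@(2)),
the ♭ `Γ`-Euler characteristic at `2`, and the finite descent datum ⇒ `BSD(E,2)`. Any `a₂ ∈ {0, ±2}`.
[cite: Sprung2012, Thm. 7.14, 7.16, Prop. 7.19 (pp. 1504–1505)] [cite: Sprung2024, §5.2 Lemmas 5.5–5.9]
[cite: Kato2004Asterisque, Thm. 12.4–12.5] [cite: KuriharaOtsuki2006, p. 564] [cite: Miller2011LMS, Def. 1.1] -/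
theorem bsdp_two_of_flatColemanKato_of_pow_dvd
    (hmod : nonempty_modularParametrizationData)
    (hGZK : rank_eq_analyticRank_of_analyticRank_le_one)
    (h124 : Kato2004.thm12_4) (hX0 : Kato2004_fineSelmerDual_isTorsion)
    (hgood : W.HasGoodReductionAtPrime 2) (hss : (2 : ℤ) ∣ W.frobeniusTrace 2)
    (hL : W.entireLFunction 1 ≠ 0)
    (hκ : κ.IsCyclotomic) (hγ : κ.IsTopGenerator γ) (hsurj : TwoAdicSurjective W)
    (hEC : ∀ (D : SharpFlatSelmerDualData W κ γ ι (W.frobeniusTrace 2) g c .flat)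
        [Module.Finite (IwasawaAlgebra 2) D.X], Module.IsTorsion (IwasawaAlgebra 2) D.X →
      ∀ f : IwasawaAlgebra 2, D.charIdeal = Ideal.span {f} → Finite (W.selmerGroupPInfty 2) →
        ∃ u : ℤ_[2]ˣ, ((PowerSeries.constantCoeff f : ℤ_[2]) : ℚ_[2]) =
          ((u : ℤ_[2]) : ℚ_[2]) * ((2 : ℕ) : ℚ_[2]) ^ (padicValNat 2 W.tamagawaProduct) *
            (Nat.card (W.selmerGroupPInfty 2) : ℚ_[2]))
    (hCK : ∀ [NeZero (W.conductorNorm ℤ)] (f : CuspForm (Gamma0 (W.conductorNorm ℤ)) 2),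
        IsNewformOf W f → ∀ (ϖ : ℚ), (ϖ : ℝ) * W.realPeriodRat = plusPeriod f →
      ∀ (Ls Lf : IwasawaAlgebra 2), IsSprungPair f 2 (W.frobeniusTrace 2) Ls Lf →
      ∀ (D : SharpFlatSelmerDualData W κ γ ι (W.frobeniusTrace 2) g c .flat)
        [ContinuousSMul ℤ_[2] (W.tateModule 2)],
        ∃ (I : Kato2004.IwasawaH1Data W 2 κ γ) (Y : W.FineSelmerDualData κ γ)
          (P : Submodule (IwasawaAlgebra 2) (IwasawaAlgebra 2))
          (loc : I.H →ₗ[IwasawaAlgebra 2] P) (toX : P →ₗ[IwasawaAlgebra 2] D.X)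
          (δ : D.X →ₗ[IwasawaAlgebra 2] Y.X) (Z : Submodule (IwasawaAlgebra 2) I.H)
          (G : IwasawaAlgebra 2),
          Function.Exact loc toX ∧ Function.Exact toX δ ∧
          G ∈ Submodule.map (P.subtype ∘ₗ loc) Z ∧
          iwasawaToPowerSeries 2 G = PowerSeries.C (ϖ : ℚ_[2]) * iwasawaToPowerSeries 2 Lf ∧
          (∀ 𝔭 : PrimeSpectrum (IwasawaAlgebra 2), 𝔭.asIdeal.height = 1 →
            PowerSeries.C (2 : ℤ_[2]) ∉ 𝔭.asIdeal →
            Literature.NumberTheory.EllipticCurves.Module.lengthAt (IwasawaAlgebra 2) Y.X 𝔭 ≤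
              Literature.NumberTheory.EllipticCurves.Module.lengthAt (IwasawaAlgebra 2) (I.H ⧸ Z) 𝔭) ∧
          (TwoAdicSurjective W →
            ∀ 𝔭 : PrimeSpectrum (IwasawaAlgebra 2), 𝔭.asIdeal.height = 1 →
              PowerSeries.C (2 : ℤ_[2]) ∈ 𝔭.asIdeal →
              Literature.NumberTheory.EllipticCurves.Module.lengthAt (IwasawaAlgebra 2) Y.X 𝔭 ≤
                Literature.NumberTheory.EllipticCurves.Module.lengthAt (IwasawaAlgebra 2) (I.H ⧸ Z) 𝔭))
    {q : ℚ} (hq : shaAn W = (q : ℂ)) {m : ℕ} (hv : padicValRat 2 q ≤ m)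
    (hdvd : 2 ^ m ∣ W.shaOrder) : BSDp W 2 :=
  bsdp_two_of_flatUpper_of_pow_dvd W ι g c hmod hGZK hgood hss hL hγ hEC
    (flatUpper_two_of_flatColemanKato W ι g c h124 hX0 hgood hss hL hκ hγ hsurj hCK) hq hv hdvd

end Door

end SSFlatRoad

end Summit.BirchSwinnertonDyer.BirchSwinnertonDyer.Theorems

end
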